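import Summits.BirchSwinnertonDyer.Rank1Residual.X4.KuriharaSurjectivityLemmaS
import HarnessLib

/-!
# ADDITIVE level lowering kills Kurihara numbers — the two-prime theorem, UNCONDITIONAL: a `τ`-system forces `δ_n(f) = 0` (cell `b2b-bsdres`, seat additive-p4 gen 31, line V51′; the SPREAD rows of CLASS-CLOSURE §3.1 N11)

HONEST FRAMING (verbatim, cell `b2b-bsdres`): the goal of the cell is to DELETE the COMBINATION-SHAPED
residual classes for ALL analytic-rank `≤ 1` curves over `ℚ` — "full BSD formula for every rank `≤ 1`
curve in class `C`" assembled STRICTLY from published theorems — so that the rank-`≤ 1` remainder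
becomes exactly the CONSTRUCTION-SHAPED classes, which are TYPED (missing-input Props), NOT attempted;
this is not "finishing BSD". This file: a research-route KERNEL THEOREM (pure algebra over an arbitrary
commutative ring; no named fact, no conjecture, nothing booked; X4 stays CONSTRUCTION-SHAPED).

## The theorem

Gen 30 (`X4/KuriharaAdditiveLevelLowering.lean`) proved: a component-free decomposition
`f = (α − α∘[ℓ₁]) + (β − β∘[ℓ₂])` of a periodic function whose Hecke derivatives form a `τ`-SYSTEM
(`d_U α = (1−[ℓ₂])τ_U`, `d_U β = −(1−[ℓ₁])τ_U`, `d_q τ_U = τ_{U∪q}` at the admissible primes) has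
vanishing Kurihara sums `δ_n(f) = ∑_{a∈(ℤ/n)ˣ} f(a/n)∏_{q∣n}ψ_q(a)`, MODULO lemma S (an explicit witness
`G`). Lemma S is now a theorem (`X4/KuriharaSurjectivityLemmaS.lean`,
`exists_periodic_phi_derivFamily_eq`): for additive characters `ψ_q` that take the value `1` — e.g.
SURJECTIVE discrete logarithms `(ℤ/q)ˣ ↠ ℤ/p^k`, the tree's standing quantifier in the Kurihara
divisibility statements — the map `γ ↦ (δ_m(d_W γ))_{(W,m)}` is onto. This file assembles the two:
**`kuriharaSum_twoPrime_eq_zero`**, the two-prime additivity theorem with NO auxiliary hypothesis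
(restrict the predicate of admissible primes to the prime factors of `n`, take `G = d_• γ` from lemma S).

Context (EVIDENCE of the seat's instruments, never a Literature fact): on the rows of the cell with two
split Tamagawa primes the component-free level-lowering exponent is ADDITIVE (`= e₁ + e₂`, Pollack–Weston's
quantitative level lowering observed on `p² ∣ N` rows) and a `τ`-system exists at `k = e₁ + e₂` on every
decided row; with this theorem such a certificate yields `p^{e₁+e₂} ∣ δ_n` for all Kolyvagin levels `n`.

## References

* B. Mazur, J. Tate, J. Teitelbaum, Invent. Math. 84 (1986), §I.4 (4.2). [cite: MazurTateTeitelbaum1986Invent, §I.4 (4.2)]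
* M. Kurihara, Contrib. Math. Comput. Sci. 7 (2014) 317–356, §1.1 (1)–(2). [cite: Kurihara2014, §1.1]
* R. Pollack, T. Weston, Compos. Math. 147 (2011) 1353–1381. [cite: PollackWeston2011, Thm. 6.11 of arXiv:math/0610694 (quantitative level lowering, restated as Kim–Ota 2019 Thm. 1.2); provenance, not an input here (printed for p ≥ 5, p ∤ N square-free; the X4 rows are the ANALOGUE at p ∣ N)]
* C.-H. Kim, K. Ota, arXiv:1905.02926, Conj. 1.1, Thm. 1.3. [cite: KimOta2019CongruenceIdeals, Conj. 1.1 and Thm. 1.3 (text chunk p0003); provenance, not an input here (p ∤ N and N⁻ square-free there)]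
-/

noncomputable section

open scoped MatrixGroups ModularForm

open CongruenceSubgroup Finset

open Literature.NumberTheory.EllipticCurves Literature.NumberTheory.EllipticCurves.ModularForms

namespace Summit.BirchSwinnertonDyer.Rank1Residual.LevelLowering

variable {R : Type*} [CommRing R] (ψ : (ℓ : ℕ) → (ZMod ℓ)ˣ →* Multiplicative R)

/-- **ADDITIVE LEVEL LOWERING KILLS KURIHARA SUMS (two primes) — unconditional.** Data over the primes
of a predicate `P` (all prime, prime to `ℓ₁` and to `ℓ₂`): derivative families `Dα`, `Dβ`
(`H_q (D U) = 2·D U + D(U ∪ {q})` for `q ∉ U`), a `τ`-SYSTEM `τ U` on the non-empty `P`-sets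
(`H_q τ_U = 2τ_U + τ_{U∪q}`; `Dα U = τ_U − τ_U∘[ℓ₂]`, `Dβ U = −(τ_U − τ_U∘[ℓ₁])`), a square-free
`n` with `P`-prime factors, and additive characters `ψ_q` taking the value `1` at the primes of `n`
(e.g. surjective discrete logarithms). Then the Kurihara sum at `n` of
`f = (Dα ∅ − Dα ∅∘[ℓ₁]) + (Dβ ∅ − Dβ ∅∘[ℓ₂])` vanishes:
`∑_{a ∈ (ℤ/n)ˣ} f(a/n) ∏_{q∣n} ψ_q(a) = 0`. (Gen 30's theorem modulo lemma S, with the lemma-S witness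
`G = d_• γ` supplied by `exists_periodic_phi_derivFamily_eq` on the prime factors of `n`.)
[cite: Kurihara2014, §1.1 (1)–(2)] [cite: MazurTateTeitelbaum1986Invent, §I.4 (4.2)]
[cite: PollackWeston2011, Thm. 6.11 of arXiv:math/0610694 (quantitative level lowering, restated as Kim–Ota 2019 Thm. 1.2); provenance, not an input here (printed for p ≥ 5, p ∤ N square-free; the X4 rows are the ANALOGUE at p ∣ N)] -/
theorem kuriharaSum_twoPrime_eq_zero {P : ℕ → Prop} {ℓ₁ ℓ₂ : ℕ}
    (hP : ∀ q, P q → q.Prime ∧ q.Coprime ℓ₁ ∧ q.Coprime ℓ₂)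
    (Dα Dβ τ : Finset ℕ → ℚ → R)
    (hperα : ∀ U, IsPeriodic (Dα U)) (hperβ : ∀ U, IsPeriodic (Dβ U))
    (hperτ : ∀ U, IsPeriodic (τ U))
    (hDα : ∀ (U : Finset ℕ) (q : ℕ), P q → q ∉ U →
      ∀ r : ℚ, heckeTransform q (Dα U) r = 2 * Dα U r + Dα (insert q U) r)
    (hDβ : ∀ (U : Finset ℕ) (q : ℕ), P q → q ∉ U →
      ∀ r : ℚ, heckeTransform q (Dβ U) r = 2 * Dβ U r + Dβ (insert q U) r)
    (hDτ : ∀ (U : Finset ℕ), U.Nonempty → ∀ (q : ℕ), P q → q ∉ U →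
      ∀ r : ℚ, heckeTransform q (τ U) r = 2 * τ U r + τ (insert q U) r)
    (h1 : ∀ U : Finset ℕ, U.Nonempty → (∀ q ∈ U, P q) → ∀ r : ℚ, Dα U r = τ U r - τ U (ℓ₂ * r))
    (h2 : ∀ U : Finset ℕ, U.Nonempty → (∀ q ∈ U, P q) → ∀ r : ℚ, Dβ U r = -(τ U r - τ U (ℓ₁ * r)))
    (n : ℕ) [NeZero n] (hn : Squarefree n) (hPn : ∀ q ∈ n.primeFactors, P q)
    (hψ : ∀ q ∈ n.primeFactors, ∃ u : (ZMod q)ˣ, ψ q u = Multiplicative.ofAdd 1) :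
    ∑ a : (ZMod n)ˣ, ((Dα ∅ ((((a : ZMod n).val : ℕ) : ℚ) / n) -
        Dα ∅ ((ℓ₁ : ℚ) * ((((a : ZMod n).val : ℕ) : ℚ) / n))) +
        (Dβ ∅ ((((a : ZMod n).val : ℕ) : ℚ) / n) -
        Dβ ∅ ((ℓ₂ : ℚ) * ((((a : ZMod n).val : ℕ) : ℚ) / n)))) *
        weight ψ n n.primeFactors a = 0 := by
  classical
  -- restrict the admissible primes to the prime factors of `n`
  have hP' : ∀ q, q ∈ n.primeFactors → q.Prime ∧ q.Coprime ℓ₁ ∧ q.Coprime ℓ₂ :=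
    fun q hq ↦ hP q (hPn q hq)
  have hQ : ∀ q ∈ n.primeFactors, q.Prime := fun q hq ↦ Nat.prime_of_mem_primeFactors hq
  -- the lemma-S witness `γ`: `δ_m(d_W γ) = δ_m(τ_W)` on all pairs over the prime factors of `n`
  obtain ⟨γ, hγ, hSγ⟩ := exists_periodic_phi_derivFamily_eq ψ n.primeFactors hQ hψ
    fun W m ↦ PhiTot ψ (τ W) m m.primeFactors
  -- the family `G U = d_U γ` on sets of primes (junk sets ↦ 0)
  let G : Finset ℕ → ℚ → R := fun U ↦
    if (∀ q ∈ U, q.Prime) then derivFamily γ U else fun _ ↦ 0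
  have hG_of : ∀ U : Finset ℕ, (∀ q ∈ U, q.Prime) → G U = derivFamily γ U := fun U h ↦ if_pos h
  have hG_not : ∀ U : Finset ℕ, ¬ (∀ q ∈ U, q.Prime) → G U = fun _ ↦ 0 := fun U h ↦ if_neg h
  have hperG : ∀ U, IsPeriodic (G U) := by
    intro U
    by_cases h : ∀ q ∈ U, q.Prime
    · rw [hG_of U h]; exact hγ.derivFamily h
    · rw [hG_not U h]; exact isPeriodic_zero
  have hDG : ∀ (U : Finset ℕ) (q : ℕ), q ∈ n.primeFactors → q ∉ U →
      ∀ r : ℚ, heckeTransform q (G U) r = 2 * G U r + G (insert q U) r := by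
    intro U q hq hqU r
    have hqp : q.Prime := (hP' q hq).1
    by_cases h : ∀ x ∈ U, x.Prime
    · have h' : ∀ x ∈ insert q U, x.Prime := by
        simp only [Finset.forall_mem_insert]
        exact ⟨hqp, h⟩
      rw [hG_of U h, hG_of _ h']
      exact heckeTransform_derivFamily hγ h hqp hqU r
    · have h' : ¬ ∀ x ∈ insert q U, x.Prime :=
        fun hh ↦ h fun x hx ↦ hh x (Finset.mem_insert_of_mem hx)
      rw [hG_not U h, hG_not _ h', heckeTransform_zero]
      simp
  have hS : ∀ (W : Finset ℕ), W.Nonempty → (∀ q ∈ W, q ∈ n.primeFactors) →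
      ∀ (m : ℕ) [NeZero m], Squarefree m → (∀ q ∈ m.primeFactors, q ∈ n.primeFactors) →
      Disjoint W m.primeFactors →
      Phi ψ (G W) m m.primeFactors = Phi ψ (τ W) m m.primeFactors := by
    intro W _ hWP m _ hm hmP hdisj
    have hWQ : W ⊆ n.primeFactors := fun q hq ↦ hWP q hq
    have hWprime : ∀ q ∈ W, q.Prime := fun q hq ↦ hQ q (hWQ hq)
    rw [hG_of W hWprime, hSγ W hWQ m hm (fun q hq ↦ hmP q hq) hdisj, PhiTot_eq_Phi]
  exact kuriharaSum_twoPrime_eq_zero_of_tauSystem ψ (P := fun q ↦ q ∈ n.primeFactors) hP'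
    Dα Dβ τ G hperα hperβ hperτ hperG
    (fun U q hq hqU ↦ hDα U q (hPn q hq) hqU) (fun U q hq hqU ↦ hDβ U q (hPn q hq) hqU) hDG
    (fun U hU q hq hqU ↦ hDτ U hU q (hPn q hq) hqU)
    (fun U hU hUP ↦ h1 U hU fun q hq ↦ hPn q (hUP q hq))
    (fun U hU hUP ↦ h2 U hU fun q hq ↦ hPn q (hUP q hq))
    hS n hn (fun _ hq ↦ hq)

end Summit.BirchSwinnertonDyer.Rank1Residual.LevelLowering

end
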